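import Literature.MathematicalPhysics.KineticTheory.ReyBelletThomas2002Semigroup
import Literature.MathematicalPhysics.KineticTheory.ReyBelletThomas2002ExpBound
import Literature.MathematicalPhysics.KineticTheory.ReyBelletThomas2002Assembly
import Literature.Probability.Process.SmallSets
import HarnessLib

/-!
# Rey-Bellet–Thomas 2002, Theorem 2.1: the assembly from Theorem 3.10 and the smooth positive law

Trunk T-KINETIC (Literature/MathematicalPhysics/KineticTheory). Inline decomposition step for the
named fact `ReyBelletThomas2002_thm21` (provefact unit). With the transition semigroup of (RBT-SDE)
CONSTRUCTED (`OscillatorChain.rbSemigroup`, `ReyBelletThomas2002Semigroup.lean`: Markov kernels,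
Chapman–Kolmogorov, Dynkin on `C_c^∞`, Feller), the a-priori bound (26) PROVED
(`ReyBelletThomas2002ExpBound.lean`), the bracket condition of Prop. 4.1 PROVED and the smooth
density of invariant measures derived from Hörmander's theorem
(`ReyBelletThomas2002SmoothDensity.lean`), and the §5 assembly (Meyn–Tweedie Thm 15 replaced by
the continuous-time Harris theorem, `ReyBelletThomas2002Assembly.lean`), the printed proof of
Theorem 2.1 (§5, pp. 27–29) needs exactly three more inputs, which this file threads as explicit
hypotheses ABOUT THE CONSTRUCTED KERNELS `OscillatorChain.rbKernel` (no new named facts):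

* **Theorem 3.10** (the Liapunov bound (39) `T^s e^{θG} ≤ κ e^{θG} + L 1_U`; §3: the scaling
  limit of Lemma 3.7 and the dissipation estimates of Props. 3.8–3.9);
* **the `C^∞` law** (§4 p. 26: "the Markov process has a `C^∞` law … a consequence of Hörmander
  Theorem [11, 16]" — smooth transition densities `p_t(x, y)`, the first clause of Theorem 2.1),
  together with the **positivity of the transition densities** (the pointwise strengthening of
  Prop. 4.2 `supp P_t(x, ·) = X` — support theorem [27] and [7, Thm 3.2] — implicit in "`μ` has a
  `C^∞` everywhere positive density");
* **Hörmander 1967, Thm 1.1** (named fact `Literature.Analysis.Distribution.Hormander1967_thm11`).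

Proved here, for every `S : MarkovSemigroupFor (P.rbGenerator Λ N T_L T_R)`:
* `rb_kernel_pos_of_pos_density` — positive densities ⟹ every nonempty open set is charged
  (§5: "strongly aperiodic, i.e., `P(x, A) > 0` for any open set `A` and for any `x`");
* `rb_minorization_of_density_of_irreducible` — continuous densities + irreducibility + Feller ⟹
  every compact set is small for all large times (the minorisation consumed by the Harris theorem;
  abstract small-set theorem of `Literature/Probability/Process/SmallSets.lean`);
* `rb_hasSmoothPosDensity_of_pos_density` — an invariant probability measure with a smooth density
  has an everywhere POSITIVE density as soon as the transition densities at one time are continuous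
  and positive (`ρ(y) ≥ ∫ ρ(x) p_t(x, y) μ(dx)`-type bound: Tonelli, a.e. uniqueness of densities,
  Fatou along a sequence from the full-measure set, `ρ` continuous);
* `rb_h39_of_thm310` — Thm 3.10 in printed form ⟹ the drift input `h39` of the assembly;
* `ReyBelletThomas2002_thm21_of_inputs` (fixed chain data) and
  `ReyBelletThomas2002_thm21_of_thm310_of_law_of_hormander` — **Theorem 2.1 from the three
  inputs**, with the witness `S = rbSemigroup`.

## References

* L. Rey-Bellet, L. E. Thomas, Comm. Math. Phys. 225 (2002) 305–329, Thm 2.1, Lemma 3.5 (26),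
  Thm 3.10 (39), Props. 4.1–4.2, §5.
* S. P. Meyn, R. L. Tweedie, *Markov Chains and Stochastic Stability* (1993), Ch. 15. [folklore]
-/

noncomputable section

open MeasureTheory ProbabilityTheory Filter Topology Set Literature.Probability.Process
open scoped NNReal ENNReal BoundedContinuousFunction ContDiff

namespace Literature.MathematicalPhysics.KineticTheory.HeatConduction

open Literature.Analysis.Distribution (Hormander1967_thm11)

variable {N : ℕ}

namespace MarkovSemigroupFor

variable {P : OscillatorChain} {Λ T_L T_R : ℝ} (S : MarkovSemigroupFor (P.rbGenerator Λ N T_L T_R))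

/-! ### Positive continuous transition densities: irreducibility and small sets -/

/-- **Strong aperiodicity from positive densities**: if `P_t(x, dy) = p(x, y) dy` at one time
`t` with `p(x, ·) > 0` measurable, then `P_t(x, U) > 0` for every nonempty open `U` (§5: "the
Markov chain is strongly aperiodic, i.e., `P(x, A) > 0` for any open set `A` and for any `x`").
[cite: ReyBelletThomas2002, §5] -/
theorem rb_kernel_pos_of_pos_density {t : ℝ≥0} {p : RBPhaseSpace N → RBPhaseSpace N → ℝ}
    (hpm : ∀ x, Measurable (p x))
    (hpt : ∀ x, S.kernel t x =
      (volume : Measure (RBPhaseSpace N)).withDensity fun y => ENNReal.ofReal (p x y))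
    (hpos : ∀ x y, 0 < p x y) (z : RBPhaseSpace N) {U : Set (RBPhaseSpace N)} (hU : IsOpen U)
    (hne : U.Nonempty) : 0 < S.kernel t z U := by
  haveI := isAddHaarMeasure_volume_rbPhaseSpace N
  rw [hpt z, withDensity_apply _ hU.measurableSet, pos_iff_ne_zero]
  intro h0
  have hae : ∀ᵐ y ∂(volume : Measure (RBPhaseSpace N)).restrict U, ENNReal.ofReal (p z y) = 0 :=
    (lintegral_eq_zero_iff' (ENNReal.measurable_ofReal.comp (hpm z)).aemeasurable).1 h0
  have hF : ∀ᵐ y ∂(volume : Measure (RBPhaseSpace N)).restrict U, False :=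
    hae.mono fun y hy => (ENNReal.ofReal_pos.2 (hpos z y)).ne' hy
  have h1 : (volume : Measure (RBPhaseSpace N)).restrict U = 0 :=
    ae_eq_bot.1 (eventually_false_iff_eq_bot.1 hF)
  exact (hU.measure_pos volume hne).ne' (Measure.restrict_eq_zero.1 h1)

/-- **Every compact set is small for all large times, from continuous transition densities and
irreducibility** (the minorisation used in §5 through Meyn–Tweedie Ch. 15 / the Harris theorem):
for a Feller `S : MarkovSemigroupFor (P.rbGenerator Λ N T_L T_R)` whose kernels have, for `t > 0`,
densities `p_t(x, ·)` with `(t, x, y) ↦ p_t(x, y)` continuous on `(0, ∞) × X × X`, and which charges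
every nonempty open set from every point at some time, for every compact `C` there is `t_C` such
that for all `t ≥ t_C` some nonzero measure `ν` satisfies `ν ≤ P_t(z, ·)` for all `z ∈ C`
(abstract small-set theorem with the open-positive reference measure `volume`).
[cite: ReyBelletThomas2002, §5] -/
theorem rb_minorization_of_density_of_irreducible
    (hFeller : ∀ (t : ℝ≥0) (g : RBPhaseSpace N →ᵇ ℝ), Continuous (S.act t g))
    (hdens : ∃ p : ℝ → RBPhaseSpace N → RBPhaseSpace N → ℝ,
      ContinuousOn (fun w : ℝ × RBPhaseSpace N × RBPhaseSpace N => p w.1 w.2.1 w.2.2)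
        (Set.Ioi (0 : ℝ) ×ˢ Set.univ) ∧
      ∀ t : ℝ≥0, 0 < t → ∀ x : RBPhaseSpace N,
        S.kernel t x = (volume : Measure (RBPhaseSpace N)).withDensity
          fun y => ENNReal.ofReal (p t x y))
    (hirr : ∀ (z : RBPhaseSpace N) (U : Set (RBPhaseSpace N)), IsOpen U → U.Nonempty →
      ∃ t : ℝ≥0, 0 < S.kernel t z U) :
    ∀ C : Set (RBPhaseSpace N), IsCompact C → ∃ t_C : ℝ≥0, ∀ t : ℝ≥0, t_C ≤ t →
      ∃ ν : Measure (RBPhaseSpace N), ν ≠ 0 ∧ ∀ z ∈ C, ν ≤ S.kernel t z := by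
  haveI := isAddHaarMeasure_volume_rbPhaseSpace N
  obtain ⟨p, hp, hκ⟩ := hdens
  -- the `ℝ≥0`-valued densities of the abstract theorem
  set p' : ℝ≥0 → RBPhaseSpace N → RBPhaseSpace N → ℝ≥0 := fun t x y => (p t x y).toNNReal with hp'
  have hφ : Continuous fun q : ℝ≥0 × RBPhaseSpace N × RBPhaseSpace N => (((q.1 : ℝ≥0) : ℝ), q.2) := by
    fun_prop
  have h2 : ContinuousOn (fun q : ℝ≥0 × RBPhaseSpace N × RBPhaseSpace N => p q.1 q.2.1 q.2.2)
      {q | 0 < q.1} :=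
    hp.comp hφ.continuousOn fun q hq => ⟨NNReal.coe_pos.2 hq, mem_univ _⟩
  have hp'c : ContinuousOn (fun q : ℝ≥0 × RBPhaseSpace N × RBPhaseSpace N => p' q.1 q.2.1 q.2.2)
      {q | 0 < q.1} :=
    continuous_real_toNNReal.comp_continuousOn h2
  have hκ' : ∀ t : ℝ≥0, 0 < t → ∀ z : RBPhaseSpace N,
      S.kernel t z = (volume : Measure (RBPhaseSpace N)).withDensity fun y => (p' t z y : ℝ≥0∞) :=
    fun t ht z => hκ t ht z
  have hF : ∀ (t : ℝ≥0) (g : RBPhaseSpace N →ᵇ ℝ), Continuous fun x => ∫ y, g y ∂(S.kernel t x) :=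
    hFeller
  obtain ⟨U₀, hU₀, hU₀ne, hsmall⟩ := MarkovSemigroup.exists_smul_restrict_le_of_isCompact
    S.kernel S.kernel_add hF hirr p' hp'c hκ'
  intro C hC
  obtain ⟨t_C, ht_C⟩ := hsmall C hC
  refine ⟨t_C, fun t ht => ?_⟩
  obtain ⟨ε, hε, hle⟩ := ht_C t ht
  refine ⟨ε • (volume : Measure (RBPhaseSpace N)).restrict U₀, ?_, hle⟩
  intro h0
  have h1 : (ε • (volume : Measure (RBPhaseSpace N)).restrict U₀) U₀ = 0 := by
    rw [h0, Measure.coe_zero, Pi.zero_apply]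
  rw [Measure.smul_apply, Measure.restrict_apply hU₀.measurableSet, Set.inter_self,
    smul_eq_mul] at h1
  exact (ENNReal.mul_pos hε.ne' (hU₀.measure_pos volume hU₀ne).ne').ne' h1

/-! ### Positivity of a smooth invariant density -/

/-- **A smooth invariant density is everywhere positive when the transition densities at one time
are continuous and positive.** If `μ = ρ · Leb` is an invariant probability measure with
`ρ ∈ C^∞` (any sign: the representation forces `ρ > 0`), and `P_t(x, dy) = p(x, y) dy` with `(x, y) ↦ p(x, y)` continuous and `p > 0`,
then `ρ > 0` everywhere: by invariance and Tonelli `ρ = ∫ p(x, ·) μ(dx)` a.e.; the right side is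
positive everywhere (`μ ≠ 0`, `p > 0`) and lower semicontinuous (Fatou), `ρ` is continuous and the
a.e.-set is dense, so `ρ(y) ≥ ∫ p(x, y) μ(dx) > 0`. This is the mechanism behind "`μ` has a `C^∞`
everywhere positive density" of Thm 2.1. [cite: ReyBelletThomas2002, Thm 2.1] -/
theorem rb_hasSmoothPosDensity_of_pos_density {μ : Measure (RBPhaseSpace N)} [IsProbabilityMeasure μ]
    (hinv : S.IsInvariant μ) {g : RBPhaseSpace N → ℝ} (hg : ContDiff ℝ ∞ g)
    (hμ : μ = (volume : Measure (RBPhaseSpace N)).withDensity fun x => ENNReal.ofReal (g x))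
    {t : ℝ≥0} {p : RBPhaseSpace N → RBPhaseSpace N → ℝ}
    (hpc : Continuous fun q : RBPhaseSpace N × RBPhaseSpace N => p q.1 q.2)
    (hpt : ∀ x, S.kernel t x =
      (volume : Measure (RBPhaseSpace N)).withDensity fun y => ENNReal.ofReal (p x y))
    (hpos : ∀ x y, 0 < p x y) : HasSmoothPosDensity μ := by
  haveI := isAddHaarMeasure_volume_rbPhaseSpace N
  refine ⟨g, hg, fun y₀ => ?_, hμ⟩
  -- the candidate density `G(y) = ∫ p(x, y) μ(dx)`
  set F : RBPhaseSpace N × RBPhaseSpace N → ℝ≥0∞ := fun q => ENNReal.ofReal (p q.1 q.2) with hF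
  have hFm : Measurable F := ENNReal.measurable_ofReal.comp hpc.measurable
  set G : RBPhaseSpace N → ℝ≥0∞ := fun y => ∫⁻ x, F (x, y) ∂μ with hGdef
  have hGm : Measurable G := hFm.lintegral_prod_left'
  have hgm : Measurable fun y => ENNReal.ofReal (g y) :=
    ENNReal.measurable_ofReal.comp hg.continuous.measurable
  -- (1) invariance + Tonelli: `volume.withDensity (ofReal ∘ g) = volume.withDensity G`
  have heq : (volume : Measure (RBPhaseSpace N)).withDensity (fun y => ENNReal.ofReal (g y)) =
      (volume : Measure (RBPhaseSpace N)).withDensity G := by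
    refine Measure.ext fun A hA => ?_
    rw [← hμ, ← hinv.lintegral_kernel S t hA, withDensity_apply _ hA]
    have h1 : ∀ x, S.kernel t x A = ∫⁻ y in A, F (x, y) ∂volume := fun x => by
      rw [hpt x, withDensity_apply _ hA]
    simp_rw [h1]
    rw [lintegral_lintegral_swap (f := fun x y => F (x, y))
      (hFm.comp (measurable_fst.prodMk measurable_snd)).aemeasurable]
  have hae : (fun y => ENNReal.ofReal (g y)) =ᵐ[(volume : Measure (RBPhaseSpace N))] G :=
    (withDensity_eq_iff_of_sigmaFinite hgm.aemeasurable hGm.aemeasurable).1 heq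
  -- (2) `G(y₀) > 0`
  have hGpos : 0 < G y₀ := by
    refine pos_iff_ne_zero.2 fun h0 => ?_
    have h1 : (fun x => F (x, y₀)) =ᵐ[μ] 0 :=
      (lintegral_eq_zero_iff (hFm.comp (measurable_id.prodMk measurable_const))).1 h0
    have h2 : ∀ᵐ x ∂μ, False := h1.mono fun x hx => (ENNReal.ofReal_pos.2 (hpos x y₀)).ne' hx
    have h3 : μ = 0 := ae_eq_bot.1 (eventually_false_iff_eq_bot.1 h2)
    exact (IsProbabilityMeasure.ne_zero μ) h3
  -- (3) `G(y₀) ≤ ofReal (g y₀)` by lower semicontinuity along a sequence from the a.e.-set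
  have hdense : Dense {y : RBPhaseSpace N | ENNReal.ofReal (g y) = G y} := Measure.dense_of_ae hae
  obtain ⟨u, hu, hut⟩ := mem_closure_iff_seq_limit.1 (hdense.closure_eq.symm ▸ mem_univ y₀ :
    y₀ ∈ closure {y : RBPhaseSpace N | ENNReal.ofReal (g y) = G y})
  have hGle : G y₀ ≤ ENNReal.ofReal (g y₀) := by
    have hlim : ∀ x, Tendsto (fun n => F (x, u n)) atTop (𝓝 (F (x, y₀))) := fun x =>
      ((ENNReal.continuous_ofReal.comp hpc).tendsto (x, y₀)).comp
        (tendsto_const_nhds.prodMk_nhds hut)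
    calc G y₀ = ∫⁻ x, liminf (fun n => F (x, u n)) atTop ∂μ :=
          lintegral_congr fun x => ((hlim x).liminf_eq).symm
      _ ≤ liminf (fun n => ∫⁻ x, F (x, u n) ∂μ) atTop :=
          lintegral_liminf_le fun n => hFm.comp (measurable_id.prodMk measurable_const)
      _ = liminf (fun n => ENNReal.ofReal (g (u n))) atTop :=
          liminf_congr (Eventually.of_forall fun n => (hu n).symm)
      _ = ENNReal.ofReal (g y₀) :=
          (((ENNReal.continuous_ofReal.comp hg.continuous).tendsto y₀).comp hut).liminf_eq
  exact ENNReal.ofReal_pos.1 (hGpos.trans_le hGle)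

/-! ### Theorem 3.10 in printed form gives the drift input of the assembly -/

/-- Thm 3.10 as printed ("Let `s > 0` and `θ < θ₀`. Then there are a compact set `U` and
constants `κ < 1` and `L < ∞` such that `T^s exp(θG)(x) ≤ κ exp(θG)(x) + L 1_U(x)`"), stated for
the kernels of `S`, implies the drift hypothesis `h39` of `ReyBelletThomas2002Assembly.lean`
(take `s = 1`, enlarge `κ` to `max κ ½ ∈ (0,1)` and `L` to `max L 0`).
[cite: ReyBelletThomas2002, Thm 3.10] -/
theorem rb_h39_of_thm310
    (h310 : ∀ s : ℝ≥0, 0 < s → ∀ θ : ℝ, 0 < θ → θ < 1 / max T_L T_R →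
      ∃ (U : Set (RBPhaseSpace N)) (κ L : ℝ), IsCompact U ∧ κ < 1 ∧
        ∀ x, ∫⁻ y, ENNReal.ofReal (Real.exp (θ * P.rbEnergy N y)) ∂(S.kernel s x) ≤
          ENNReal.ofReal (κ * Real.exp (θ * P.rbEnergy N x) + L * U.indicator 1 x)) :
    ∀ θ : ℝ, 0 < θ → θ < 1 / max T_L T_R →
      ∃ (s : ℝ≥0) (κ L : ℝ) (U : Set (RBPhaseSpace N)), 0 < s ∧ 0 < κ ∧ κ < 1 ∧ 0 ≤ L ∧
        IsCompact U ∧ ∀ x,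
          ∫⁻ y, ENNReal.ofReal (Real.exp (θ * P.rbEnergy N y)) ∂(S.kernel s x) ≤
            ENNReal.ofReal (κ * Real.exp (θ * P.rbEnergy N x) + L * U.indicator 1 x) := by
  intro θ hθ hθ'
  obtain ⟨U, κ, L, hU, hκ, hb⟩ := h310 1 one_pos θ hθ hθ'
  refine ⟨1, max κ (1 / 2), max L 0, U, one_pos, lt_max_of_lt_right (by norm_num),
    max_lt hκ (by norm_num), le_max_right _ _, hU, fun x => (hb x).trans (ENNReal.ofReal_le_ofReal ?_)⟩
  have h1 : 0 ≤ U.indicator (1 : RBPhaseSpace N → ℝ) x := Set.indicator_nonneg (fun _ _ => zero_le_one) x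
  exact add_le_add (mul_le_mul_of_nonneg_right (le_max_left _ _) (Real.exp_pos _).le)
    (mul_le_mul_of_nonneg_right (le_max_left _ _) h1)

end MarkovSemigroupFor

/-! ### Theorem 2.1 from Theorem 3.10, the smooth positive law, and Hörmander's theorem -/

/-- **Rey-Bellet–Thomas 2002, Theorem 2.1 for given chain data, from the three remaining inputs.**
For `P = (U, V, γ)` with H1 (`2 ≤ k₁ ≤ k₂`), H2, `γ, Λ > 0`, `N ≥ 2`, `T_L, T_R > 0`, assume, for the
CONSTRUCTED transition kernels `rbKernel` of (RBT-SDE): Thm 3.10 as printed (`h310`), and the `C^∞`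
law with positive densities (`hlaw`: `P_t(x, dy) = p_t(x, y) dy`, `p ∈ C^∞((0,∞) × X × X)`, `p > 0`);
assume Hörmander 1967 Thm 1.1 (`hH`). Then the full conclusion of Theorem 2.1 holds with the
witness `S = rbSemigroup`: `rb_h26` ((26), proved), `rb_h39_of_thm310`, the minorisation from
densities and strong aperiodicity, the assembly `ReyBelletThomas2002_thm21_ergodic_of_inputs`
(invariant probability measure — Krylov–Bogoliubov; uniqueness, exponential convergence (16) and
decay of correlations — Harris), the smooth invariant density
(`ReyBelletThomas2002_smoothDensity_of_hormander`) and its positivity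
(`rb_hasSmoothPosDensity_of_pos_density`). [cite: ReyBelletThomas2002, Thm 2.1] -/
theorem ReyBelletThomas2002_thm21_of_inputs (hH : Hormander1967_thm11)
    {P : OscillatorChain} {Λ k₁ k₂ : ℝ} (hk₁ : 2 ≤ k₁) (hk₁₂ : k₁ ≤ k₂)
    (hU : RBGrowth P.U k₁) (hV : RBGrowth P.V k₂) (hV2 : RBNondegenerate P.V) (hγ : 0 < P.γ)
    (hΛ : 0 < Λ) {N : ℕ} {T_L T_R : ℝ} (_hN : 2 ≤ N) (hL : 0 < T_L) (hR : 0 < T_R)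
    (h310 : ∀ s : ℝ≥0, 0 < s → ∀ θ : ℝ, 0 < θ → θ < 1 / max T_L T_R →
      ∃ (U : Set (RBPhaseSpace N)) (κ L : ℝ), IsCompact U ∧ κ < 1 ∧
        ∀ x, ∫⁻ y, ENNReal.ofReal (Real.exp (θ * P.rbEnergy N y)) ∂(P.rbKernel Λ N T_L T_R s x) ≤
          ENNReal.ofReal (κ * Real.exp (θ * P.rbEnergy N x) + L * U.indicator 1 x))
    (hlaw : ∃ p : ℝ → RBPhaseSpace N → RBPhaseSpace N → ℝ,
      ContDiffOn ℝ ∞ (fun w : ℝ × RBPhaseSpace N × RBPhaseSpace N => p w.1 w.2.1 w.2.2)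
        (Set.Ioi (0 : ℝ) ×ˢ Set.univ) ∧
      (∀ t : ℝ≥0, 0 < t → ∀ x : RBPhaseSpace N,
        P.rbKernel Λ N T_L T_R t x = (volume : Measure (RBPhaseSpace N)).withDensity
          fun y => ENNReal.ofReal (p t x y)) ∧
      ∀ t : ℝ, 0 < t → ∀ x y : RBPhaseSpace N, 0 < p t x y) :
    ∃ S : MarkovSemigroupFor (P.rbGenerator Λ N T_L T_R),
      (∃ p : ℝ → RBPhaseSpace N → RBPhaseSpace N → ℝ,
        ContDiffOn ℝ ∞ (fun w : ℝ × RBPhaseSpace N × RBPhaseSpace N => p w.1 w.2.1 w.2.2)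
          (Set.Ioi (0 : ℝ) ×ˢ Set.univ) ∧
        ∀ t : ℝ≥0, 0 < t → ∀ x : RBPhaseSpace N,
          S.kernel t x = (volume : Measure (RBPhaseSpace N)).withDensity
            fun y => ENNReal.ofReal (p t x y)) ∧
      ∃ μ : Measure (RBPhaseSpace N), IsProbabilityMeasure μ ∧ S.IsInvariant μ ∧
        (∀ ν : Measure (RBPhaseSpace N), IsProbabilityMeasure ν → S.IsInvariant ν → ν = μ) ∧
        HasSmoothPosDensity μ ∧
        ∀ θ : ℝ, 0 < θ → θ < 1 / max T_L T_R →
          Integrable (fun y => Real.exp (θ * P.rbEnergy N y)) μ ∧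
          (∀ (t : ℝ≥0) (x : RBPhaseSpace N),
            Integrable (fun y => Real.exp (θ * P.rbEnergy N y)) (S.kernel t x)) ∧
          ∃ r R : ℝ, 1 < r ∧ 0 ≤ R ∧
            (∀ (x : RBPhaseSpace N) (t : ℝ≥0) (f : RBPhaseSpace N → ℝ), Measurable f →
              (∀ y, |f y| ≤ Real.exp (θ * P.rbEnergy N y)) →
              |S.act t f x - ∫ y, f y ∂μ| ≤
                R * r ^ (-(t : ℝ)) * Real.exp (θ * P.rbEnergy N x)) ∧
            (∀ (t : ℝ≥0) (f g : RBPhaseSpace N → ℝ) (a b : ℝ), 0 < (t : ℝ) →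
              Measurable f → Measurable g →
              (∀ y, f y ^ 2 ≤ a * Real.exp (θ * P.rbEnergy N y)) →
              (∀ y, g y ^ 2 ≤ b * Real.exp (θ * P.rbEnergy N y)) →
              |∫ y, g y * S.act t f y ∂μ - (∫ y, f y ∂μ) * ∫ y, g y ∂μ| ≤
                R * r ^ (-(t : ℝ)) * Real.sqrt a * Real.sqrt b) := by
  have hk1 : 1 ≤ k₁ := by linarith
  have hk2 : 1 ≤ k₂ := by linarith
  set S := P.rbSemigroup hU hV hk1 hk2 hγ.le Λ N T_L T_R hL.le hR.le with hS
  have hSk : ∀ t, S.kernel t = P.rbKernel Λ N T_L T_R t := fun t => rfl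
  obtain ⟨p, hp, hdens, hpos⟩ := hlaw
  have hdens' : ∀ t : ℝ≥0, 0 < t → ∀ x : RBPhaseSpace N,
      S.kernel t x = (volume : Measure (RBPhaseSpace N)).withDensity fun y => ENNReal.ofReal (p t x y) :=
    fun t ht x => hdens t ht x
  refine ⟨S, ⟨p, hp, hdens'⟩, ?_⟩
  -- the inputs of the assembly
  have hUc : Continuous P.U := hU.continuous
  have hVc : Continuous P.V := hV.continuous
  have hcpt : ∀ E : ℝ, IsCompact {x : RBPhaseSpace N | P.rbEnergy N x ≤ E} :=
    P.isCompact_setOf_rbEnergy_le hU hV hk1 hk2 N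
  have hFeller : ∀ (t : ℝ≥0) (g : RBPhaseSpace N →ᵇ ℝ), Continuous (S.act t g) :=
    OscillatorChain.continuous_act_rbSemigroup hU hV hk1 hk2 hγ.le Λ N hL.le hR.le
  have h26 := S.rb_h26 hU hV hk1 hk2 hγ.le hL hR
  have h310' : ∀ s : ℝ≥0, 0 < s → ∀ θ : ℝ, 0 < θ → θ < 1 / max T_L T_R →
      ∃ (U : Set (RBPhaseSpace N)) (κ L : ℝ), IsCompact U ∧ κ < 1 ∧
        ∀ x, ∫⁻ y, ENNReal.ofReal (Real.exp (θ * P.rbEnergy N y)) ∂(S.kernel s x) ≤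
          ENNReal.ofReal (κ * Real.exp (θ * P.rbEnergy N x) + L * U.indicator 1 x) := h310
  have h39 := S.rb_h39_of_thm310 h310'
  -- densities at time `1`: continuous in `(x, y)`, positive
  have hp1 : Continuous fun q : RBPhaseSpace N × RBPhaseSpace N => p 1 q.1 q.2 := by
    have h1 : ContinuousOn (fun q : RBPhaseSpace N × RBPhaseSpace N => ((1 : ℝ), q)) univ :=
      (Continuous.prodMk_right (1 : ℝ)).continuousOn
    have h2 := hp.continuousOn.comp h1 fun q _ => ⟨(zero_lt_one : (0 : ℝ) < 1), mem_univ _⟩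
    exact continuousOn_univ.1 h2
  have hpt1 : ∀ x, S.kernel 1 x =
      (volume : Measure (RBPhaseSpace N)).withDensity fun y => ENNReal.ofReal (p 1 x y) := by
    intro x
    have := hdens' 1 one_pos x
    simpa using this
  have hpos1 : ∀ x y : RBPhaseSpace N, 0 < p 1 x y := hpos 1 one_pos
  have hirr : ∀ (z : RBPhaseSpace N) (U : Set (RBPhaseSpace N)), IsOpen U → U.Nonempty →
      ∃ t : ℝ≥0, 0 < S.kernel t z U := fun z U hUo hne =>
    ⟨1, S.rb_kernel_pos_of_pos_density (fun x => (hp1.comp (Continuous.prodMk_right x)).measurable)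
      hpt1 hpos1 z hUo hne⟩
  have hsmall := S.rb_minorization_of_density_of_irreducible hFeller ⟨p, hp.continuousOn, hdens'⟩ hirr
  obtain ⟨μ, hμ, hinv, huniq, hθ⟩ :=
    ReyBelletThomas2002_thm21_ergodic_of_inputs hUc hVc hγ.le hL hR hcpt S hFeller h26 h39 hsmall
  haveI := hμ
  obtain ⟨g, hg, -, hμg⟩ :=
    ReyBelletThomas2002_smoothDensity_of_hormander hH hU.1 hV.1 hV2 hγ hΛ.ne' hL hR S hinv
  have hposμ : HasSmoothPosDensity μ :=
    S.rb_hasSmoothPosDensity_of_pos_density hinv hg hμg hp1 hpt1 hpos1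
  exact ⟨μ, hμ, hinv, huniq, hposμ, hθ⟩

/-- **Rey-Bellet–Thomas 2002, Theorem 2.1 (`ReyBelletThomas2002_thm21`) from Theorem 3.10, the
smooth positive law of the constructed process, and Hörmander's theorem.** After this file the named
fact rests on exactly: RBT Thm 3.10 (the Liapunov bound (39) for the constructed kernels — §3 of the
paper), the `C^∞` positive transition densities of the constructed kernels (§4: Hörmander's
theorem for `∂_t - L` and the support theorem), and Hörmander 1967 Thm 1.1.
[cite: ReyBelletThomas2002, Thm 2.1] -/
theorem ReyBelletThomas2002_thm21_of_thm310_of_law_of_hormander (hH : Hormander1967_thm11)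
    (h310 : ∀ (P : OscillatorChain) (Λ : ℝ) (k₁ k₂ : ℝ), 2 ≤ k₁ → k₁ ≤ k₂ →
      RBGrowth P.U k₁ → RBGrowth P.V k₂ → RBNondegenerate P.V → 0 < P.γ → 0 < Λ →
      ∀ (N : ℕ) (T_L T_R : ℝ), 2 ≤ N → 0 < T_L → 0 < T_R →
        ∀ s : ℝ≥0, 0 < s → ∀ θ : ℝ, 0 < θ → θ < 1 / max T_L T_R →
          ∃ (U : Set (RBPhaseSpace N)) (κ L : ℝ), IsCompact U ∧ κ < 1 ∧
            ∀ x, ∫⁻ y, ENNReal.ofReal (Real.exp (θ * P.rbEnergy N y)) ∂(P.rbKernel Λ N T_L T_R s x) ≤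
              ENNReal.ofReal (κ * Real.exp (θ * P.rbEnergy N x) + L * U.indicator 1 x))
    (hlaw : ∀ (P : OscillatorChain) (Λ : ℝ) (k₁ k₂ : ℝ), 2 ≤ k₁ → k₁ ≤ k₂ →
      RBGrowth P.U k₁ → RBGrowth P.V k₂ → RBNondegenerate P.V → 0 < P.γ → 0 < Λ →
      ∀ (N : ℕ) (T_L T_R : ℝ), 2 ≤ N → 0 < T_L → 0 < T_R →
        ∃ p : ℝ → RBPhaseSpace N → RBPhaseSpace N → ℝ,
          ContDiffOn ℝ ∞ (fun w : ℝ × RBPhaseSpace N × RBPhaseSpace N => p w.1 w.2.1 w.2.2)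
            (Set.Ioi (0 : ℝ) ×ˢ Set.univ) ∧
          (∀ t : ℝ≥0, 0 < t → ∀ x : RBPhaseSpace N,
            P.rbKernel Λ N T_L T_R t x = (volume : Measure (RBPhaseSpace N)).withDensity
              fun y => ENNReal.ofReal (p t x y)) ∧
          ∀ t : ℝ, 0 < t → ∀ x y : RBPhaseSpace N, 0 < p t x y) :
    ReyBelletThomas2002_thm21 := by
  intro P Λ k₁ k₂ hk₁ hk₁₂ hU hV hV2 hγ hΛ N T_L T_R hN hL hR
  exact ReyBelletThomas2002_thm21_of_inputs hH hk₁ hk₁₂ hU hV hV2 hγ hΛ hN hL hR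
    (h310 P Λ k₁ k₂ hk₁ hk₁₂ hU hV hV2 hγ hΛ N T_L T_R hN hL hR)
    (hlaw P Λ k₁ k₂ hk₁ hk₁₂ hU hV hV2 hγ hΛ N T_L T_R hN hL hR)

end Literature.MathematicalPhysics.KineticTheory.HeatConduction
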